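import Mathlib
import HarnessLib

/-!
# The DELTA METHOD in one dimension: `aₙ(Xₙ − θ) ⇒ Z`, `aₙ → ∞`, `g` differentiable at `θ`
# ⇒ `aₙ(g(Xₙ) − g(θ)) ⇒ g′(θ)·Z` — with its two lemmas: convergence in distribution to a
# constant is convergence in probability, and continuous mapping in probability at a point

HONEST FRAMING: exact (Metropolis-corrected) sampling algorithms for lattice gauge theory;
figures of merit are autocorrelation/cost numbers at stated couplings and volumes; no
continuum-physics claim.

Venture `LatticeQCDFlow` (cell pub-lqcd), topic `Scoring`; FANOUT row 4 (`s0-u1-b`, rung S0-B).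
Row 4's asymptotic-normality packet (`Scoring/SelfNormalisedReweightingCLT`,
`…/AllPairsAcceptanceRatioCLT`, `…/KishESSCLT` and their studentised versions) repeatedly
needs derived columns: a code prints `log` of the partition-function estimate (a free energy),
`1/Kₙ` (the second weight moment), `−log acc`, … .  The general tool is the delta method, which
Mathlib does not have; this file proves it for real statistics from three ingredients that are
each of independent use: (1) **`tendstoInMeasure_of_tendstoInDistribution_const`** — weak
convergence to a Dirac mass is convergence in probability (portmanteau, closed sets:
`ProbabilityMeasure.limsup_measure_closed_le_of_tendsto`); (2)
**`tendstoInMeasure_of_tendstoInDistribution_scaled`** — `aₙ(Xₙ − θ) ⇒ Z` with `aₙ → ∞` forces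
`Xₙ → θ` in probability (Slutsky with the deterministic `aₙ⁻¹ → 0`); (3)
**`tendstoInMeasure_comp_continuousAt`** — continuous mapping in probability at a point.  The
delta method **`tendstoInDistribution_deltaMethod`** then writes
`aₙ(g(Xₙ) − g(θ)) = aₙ(Xₙ − θ)·φ(Xₙ)` EXACTLY with the difference quotient `φ` (value `g′(θ)` at
`θ`), continuous at `θ` by `hasDerivAt_iff_tendsto_slope`, and applies Slutsky.  Printed
counterparts NAMED ONLY (nothing cited as a fact): Cramér (1946) §27.7; van der Vaart,
*Asymptotic Statistics* (1998) Thm 3.1.  NEW WORK of the cell (our formalisation); no definition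
is introduced.

## Content

* `tendstoInMeasure_of_tendstoInDistribution_const`,
  `tendstoInMeasure_of_tendstoInDistribution_scaled`, `tendstoInMeasure_comp_continuousAt`;
* `continuousAt_differenceQuotient`, `measurable_differenceQuotient`;
* **`tendstoInDistribution_deltaMethod`**.

NOT CLAIMED: the multivariate delta method (no multivariate CLT in Mathlib); second-order
(degenerate `g′(θ) = 0`) expansions; any number of ours re-scored.
-/

noncomputable section

namespace Summit.Ventures.LatticeQCDFlow.Scoring.CardConsistency

open MeasureTheory ProbabilityTheory Filter
open scoped Topology

section Tools

variable {Ω : Type*} [MeasurableSpace Ω] {P : Measure Ω} [IsProbabilityMeasure P]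
variable {Ω' : Type*} [MeasurableSpace Ω'] {P' : Measure Ω'} [IsProbabilityMeasure P']

/-- **Convergence in distribution to a constant is convergence in probability** (real
statistics): `Xₙ ⇒ δ_c` ⇒ `Xₙ → c` in probability. [ours] (portmanteau: for the closed set
`F = {ε ≤ |x − c|}`, `limsup P(Xₙ ∈ F) ≤ δ_c(F) = 0`) -/
theorem tendstoInMeasure_of_tendstoInDistribution_const {X : ℕ → Ω → ℝ} {c : ℝ}
    (h : TendstoInDistribution X atTop (fun _ : Ω' => c) (fun _ => P) P') :
    TendstoInMeasure P X atTop (fun _ => c) := by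
  rw [tendstoInMeasure_iff_norm]
  intro ε hε
  have hF : IsClosed {z : ℝ | ε ≤ ‖z - c‖} :=
    isClosed_le continuous_const (continuous_id.sub continuous_const).norm
  have hlim : limsup (fun n => (P.map (X n)) {z : ℝ | ε ≤ ‖z - c‖}) atTop
      ≤ (P'.map fun _ : Ω' => c) {z : ℝ | ε ≤ ‖z - c‖} :=
    ProbabilityMeasure.limsup_measure_closed_le_of_tendsto h.tendsto hF
  have h0 : (P'.map fun _ : Ω' => c) {z : ℝ | ε ≤ ‖z - c‖} = 0 := by
    rw [Measure.map_apply measurable_const hF.measurableSet]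
    have he : (fun _ : Ω' => c) ⁻¹' {z : ℝ | ε ≤ ‖z - c‖} = ∅ := by
      ext ω
      simp only [Set.mem_preimage, Set.mem_setOf_eq, sub_self, norm_zero, Set.mem_empty_iff_false,
        iff_false, not_le]
      exact hε
    rw [he, measure_empty]
  rw [h0] at hlim
  have e : (fun n => P {x | ε ≤ ‖X n x - c‖}) = fun n => (P.map (X n)) {z : ℝ | ε ≤ ‖z - c‖} :=
    funext fun n => (Measure.map_apply_of_aemeasurable (h.forall_aemeasurable n)
      hF.measurableSet).symm
  rw [e]
  exact tendsto_of_le_liminf_of_limsup_le bot_le hlim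

/-- **A `√n`-type limit law pins the centring**: `aₙ(Xₙ − θ) ⇒ Z` with `aₙ → +∞` ⇒ `Xₙ → θ` in
probability. [ours] (Slutsky with the deterministic `aₙ⁻¹ → 0`, then the previous lemma) -/
theorem tendstoInMeasure_of_tendstoInDistribution_scaled {X : ℕ → Ω → ℝ} {θ : ℝ} {a : ℕ → ℝ}
    (ha : Tendsto a atTop atTop) {Z : Ω' → ℝ}
    (h : TendstoInDistribution (fun n ω => a n * (X n ω - θ)) atTop Z (fun _ => P) P') :
    TendstoInMeasure P X atTop (fun _ => θ) := by
  -- the deterministic factor `aₙ⁻¹ → 0`, as a convergence in probability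
  have hinv : TendstoInMeasure P (fun (n : ℕ) (_ : Ω) => (a n)⁻¹) atTop (fun _ => (0 : ℝ)) :=
    tendstoInMeasure_of_tendsto_ae (fun n => aestronglyMeasurable_const)
      (Eventually.of_forall fun _ => ha.inv_tendsto_atTop)
  have hsl := h.continuous_comp_prodMk_of_tendstoInMeasure_const
    (g := fun z : ℝ × ℝ => z.2 * z.1 + θ) (by fun_prop) hinv (fun n => aemeasurable_const)
  -- its limit is the constant `θ`
  have hconst : TendstoInDistribution (fun n ω => (a n)⁻¹ * (a n * (X n ω - θ)) + θ) atTop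
      (fun _ : Ω' => θ) (fun _ => P) P' :=
    hsl.congr (fun n => Eventually.of_forall fun ω => rfl)
      (Eventually.of_forall fun ω' => by simp)
  have hP := tendstoInMeasure_of_tendstoInDistribution_const hconst
  -- and the statistic is `Xₙ` itself once `aₙ ≠ 0`
  refine hP.congr' ?_ EventuallyEq.rfl
  filter_upwards [ha.eventually_gt_atTop 0] with n hn
  exact Eventually.of_forall fun ω => by
    show (a n)⁻¹ * (a n * (X n ω - θ)) + θ = X n ω
    rw [← mul_assoc, inv_mul_cancel₀ hn.ne', one_mul, sub_add_cancel]

omit [IsProbabilityMeasure P] in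
/-- **Continuous mapping in probability at a point**: `Xₙ → θ` in probability and `φ`
continuous at `θ` ⇒ `φ(Xₙ) → φ(θ)` in probability. [ours] -/
theorem tendstoInMeasure_comp_continuousAt {X : ℕ → Ω → ℝ} {θ : ℝ}
    (h : TendstoInMeasure P X atTop (fun _ => θ)) {φ : ℝ → ℝ} (hφ : ContinuousAt φ θ) :
    TendstoInMeasure P (fun n ω => φ (X n ω)) atTop (fun _ => φ θ) := by
  rw [tendstoInMeasure_iff_norm] at h ⊢
  intro ε hε
  obtain ⟨δ, hδ, hδε⟩ := Metric.continuousAt_iff.1 hφ ε hε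
  refine tendsto_of_tendsto_of_tendsto_of_le_of_le' tendsto_const_nhds (h δ hδ)
    (Eventually.of_forall fun n => zero_le) (Eventually.of_forall fun n => ?_)
  refine measure_mono fun ω hω => ?_
  simp only [Set.mem_setOf_eq] at hω ⊢
  by_contra hlt
  have hclose : dist (X n ω) θ < δ := by
    rw [Real.dist_eq]
    exact not_le.1 hlt
  have h' := hδε hclose
  rw [Real.dist_eq] at h'
  exact absurd hω (not_le.2 h')

/-- The difference quotient `φ(x) = (g x − g θ)/(x − θ)` (value `d` at `θ`) is continuous at `θ`
when `g` has derivative `d` there. [ours] -/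
theorem continuousAt_differenceQuotient {g : ℝ → ℝ} {d θ : ℝ} (hg : HasDerivAt g d θ) :
    ContinuousAt (fun x => if x = θ then d else (g x - g θ) / (x - θ)) θ := by
  rw [← continuousWithinAt_compl_self, ContinuousWithinAt, if_pos rfl]
  have hs := hasDerivAt_iff_tendsto_slope.1 hg
  refine hs.congr' (eventually_nhdsWithin_of_forall fun x hx => ?_)
  have hx' : x ≠ θ := hx
  simp only [if_neg hx', slope_def_field]

/-- The difference quotient is measurable for a measurable `g`. [ours] -/
theorem measurable_differenceQuotient {g : ℝ → ℝ} (hgm : Measurable g) (d θ : ℝ) :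
    Measurable fun x => if x = θ then d else (g x - g θ) / (x - θ) :=
  Measurable.ite (measurableSet_eq_fun measurable_id measurable_const) measurable_const
    ((hgm.sub_const _).div (measurable_id.sub_const _))

/-- **THE DELTA METHOD (one-dimensional).**  Real statistics `Xₙ`, a centring `θ`, rates
`aₙ → +∞` with `aₙ(Xₙ − θ) ⇒ Z`; `g : ℝ → ℝ` measurable with derivative `d` at `θ`.  Then
`aₙ(g(Xₙ) − g(θ)) ⇒ d·Z` in distribution. [ours] (our formalisation of a classical theorem:
`aₙ(g(Xₙ) − g θ) = aₙ(Xₙ − θ)·φ(Xₙ)` exactly, `φ(Xₙ) → φ(θ) = d` in probability, Slutsky) -/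
theorem tendstoInDistribution_deltaMethod {X : ℕ → Ω → ℝ} {θ : ℝ} {a : ℕ → ℝ}
    (ha : Tendsto a atTop atTop) {Z : Ω' → ℝ}
    (h : TendstoInDistribution (fun n ω => a n * (X n ω - θ)) atTop Z (fun _ => P) P')
    (hXm : ∀ n, AEMeasurable (X n) P) {g : ℝ → ℝ} {d : ℝ} (hg : HasDerivAt g d θ)
    (hgm : Measurable g) :
    TendstoInDistribution (fun n ω => a n * (g (X n ω) - g θ)) atTop (fun ω' => d * Z ω')
      (fun _ => P) P' := by
  have hφm := measurable_differenceQuotient hgm d θ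
  -- `φ(Xₙ) → d` in probability
  have hX := tendstoInMeasure_of_tendstoInDistribution_scaled ha h
  have hφ := tendstoInMeasure_comp_continuousAt hX (continuousAt_differenceQuotient hg)
  simp only [if_pos] at hφ
  -- Slutsky for the product
  have hsl := h.continuous_comp_prodMk_of_tendstoInMeasure_const
    (g := fun z : ℝ × ℝ => z.1 * z.2) (by fun_prop) hφ
    (fun n => hφm.comp_aemeasurable (hXm n))
  -- the exact identity `aₙ(g Xₙ − g θ) = aₙ(Xₙ − θ)·φ(Xₙ)`
  refine hsl.congr (fun n => Eventually.of_forall fun ω => ?_)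
    (Eventually.of_forall fun ω' => mul_comm _ _)
  show a n * (X n ω - θ) * (if X n ω = θ then d else (g (X n ω) - g θ) / (X n ω - θ))
    = a n * (g (X n ω) - g θ)
  by_cases hx : X n ω = θ
  · simp [hx]
  · rw [if_neg hx, mul_assoc, mul_div_cancel₀ _ (sub_ne_zero.2 hx)]

end Tools

end Summit.Ventures.LatticeQCDFlow.Scoring.CardConsistency

end
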